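import Literature.Topology.FourManifolds.StabilisationStepCobordism
import Literature.Topology.FourManifolds.CobordismComposition
import Literature.Topology.FourManifolds.StabilisationIntersectionForm
import Literature.Topology.FourManifolds.KroneckerFreeCohomology
import Literature.Topology.FourManifolds.IntersectionFormHomotopyInvariance
import Literature.Topology.FourManifolds.SphereProductMiddleHomology
import Literature.Topology.FourManifolds.CylinderCobordism
import Literature.AlgebraicTopology.SingularHomology.LocalHomologyUniverse
import HarnessLib

/-!
# The cobordism `X ~ X # k(S² × S²)` of `k` trivially attached 2-handles, with its lattice data

Topic `Literature/Topology/FourManifolds` (fact seat of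
`Literature.Topology.FourManifolds.isHCobordant_of_equivalent_intersectionForm`, **Wall 1964,
Thm. 2**, along R. Kirby's proof, *The topology of 4-manifolds*, LNM 1374 (1989), Ch. X, proof of
Thm. 1, pp. 55–56).  Kirby: "`W` is constructed by adding `k` 2-handles to trivial circles in
`M₀` … `M_{1/2} = M₀ # k S² × S²` … The 2- and 3-handles will cancel homologically … so it is an
h-cobordism."  This file builds, for a closed simply connected smooth 4-manifold `X` and a `k`-fold
stabilisation `P` of `X` (`IsStabilization k X P`, `SmoothIntersectionForms.lean`), the half
bordism `E : X ~ P` — the composite (`Cobordism.exists_composite`, `CobordismComposition.lean`) of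
the `k` traces of chart-circle surgeries (`exists_stabilisationStep`,
`StabilisationStepCobordism.lean`; Milnor 1965, Thm. 3.12) — together with exactly the
(co)homological data Kirby's cancellation argument consumes (`exists_stabilisationCobordism`):

* `E.W` is simply connected and `H₂(P; ℤ) → H₂(E; ℤ)` is onto;
* classes `b₁, …, b_k ∈ H₂(P; ℤ)` (the belt spheres) with `inr_* bⱼ = 0`;
* an additive identification `Θ : H²(X)/T ⊕ (ℤ²)ᵏ ≅ H²(P)/T` which is an isometry
  `Q⟦±μ_X⟧ ⊥ k H ≅ Q⟦μ_P⟧` (`H` the hyperbolic plane; Kirby 1989, Ch. II §1 and Ch. X Fig. 2a,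
  the tree's `ConnectedSumNeck.exists_addEquiv_intersectionForm_eq` and
  `SphereProd.hyperbolicIsometryEquiv`), with `βⱼ = Θ (0; fⱼ)` dual to `bⱼ`:
  `⟨γ, b_l⟩ = ε_l Q_P (γ, β_l)`, `ε_l = ±1` (Kronecker pairing on cohomology mod torsion,
  `KroneckerFreeCohomology.lean`);
* "**the 2-handles kill nothing of `H₂(X)`**": every `x ∈ H₂(P)` with `⟨βⱼ, x⟩ = 0` for all `j` has
  `inr_* x ∈ im (inl_* : H₂(X) → H₂(E))`.

Everything is PROVED, by induction along `IsStabilization k X P`: the base is the cylinder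
re-ended by a diffeomorphism (`base_data`), the step composes with one trace and does the
Mayer–Vietoris / Kronecker bookkeeping of `P = M' # S² × S²` (`step_homology`, `step_form`:
`H₂(P)` comes from the two punctured pieces, the collapse maps are Kronecker-adjoint to the
pieces, `H₂(S² × S²) = ℤ y₀ ⊕ ℤ y₁` with `⟨ḡₐ, y_b⟩ = δ_{ab}`, the cylinder law and the belt law
of the trace).  No definition of mathematical content (one `abbrev` names the chosen basis of
`H²(S² × S²)/T`) and no named fact is introduced.

## References

* R. C. Kirby, *The topology of 4-manifolds*, LNM 1374, Springer (1989), Ch. X, proof of Thm. 1,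
  pp. 55–56; Ch. II §1. [Kirby1989]
* C. T. C. Wall, *On simply-connected 4-manifolds*, J. London Math. Soc. 39 (1964) 141–149, §2.
  [WallJLMS1964]
* J. Milnor, *Lectures on the h-cobordism theorem*, Princeton (1965), Thm. 3.12. [MilnorHCobordism1965]
* A. Hatcher, *Algebraic Topology*, CUP (2002), §2.2 p. 149, §3.1 p. 201, Example 3.11,
  Thm. 2.16, §3.3 p. 231. [HatcherAT2002]
* J. Milnor, D. Husemoller, *Symmetric bilinear forms*, Springer (1973), §V.1. [MilnorHusemoller1973]
-/

noncomputable section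

open scoped Manifold ContDiff Topology ContinuousMap
open Set Function Metric Topology CategoryTheory CategoryTheory.Limits
open Literature.AlgebraicTopology.SingularHomology Literature.AlgebraicTopology.Homotopy

namespace Literature.Topology.FourManifolds

/-- Local notation: `𝔼 n` is the model Euclidean space `EuclideanSpace ℝ (Fin n)`. -/
local notation "𝔼 " n:arg => EuclideanSpace ℝ (Fin n)

/-- Local notation: `𝕊 n` is the unit sphere in `EuclideanSpace ℝ (Fin (n + 1))`. -/
local notation "𝕊 " n:arg => (Metric.sphere (0 : EuclideanSpace ℝ (Fin (n + 1))) 1)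

/-! ### §A Homology of a connected sum of 4-manifolds: Mayer–Vietoris along the neck -/

namespace ConnectedSumNeck

variable {M N P : Type} [TopologicalSpace M] [T2Space M] [TopologicalSpace N] [T2Space N]
  [TopologicalSpace P] (d : ConnectedSumNeck (3 + 1) M N P)

/-- **Every class of `H₂(M # N)` comes from the two pieces** (`dim = 4`): for gluing data `d` of a
connected sum `P = M # N` of dimension `4`, every `x ∈ H₂(P; ℤ)` is `jA_* y + jB_* z` with
`y ∈ H₂(M ∖ {pt})`, `z ∈ H₂(N ∖ {pt})` (Mayer–Vietoris for the open cover `range jA ∪ range jB`,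
whose intersection, the neck `ℝ⁴ ∖ {0} ≃ S³`, has `H₁ = 0`; Hatcher 2002, §2.2 p. 149; Wall 1964,
§2 p. 144 "`H₂(N) ≅ H₂(M₁) ⊕ H₂(M₂)`"). [cite: HatcherAT2002, §2.2 p. 149] [cite: WallJLMS1964, §2 p. 144] -/
theorem exists_eq_map_jAC_add_map_jBC (x : singularHomology ℤ ℤ P 2) :
    ∃ (y : singularHomology ℤ ℤ (puncture d.i₁) 2) (z : singularHomology ℤ ℤ (puncture d.i₂) 2),
      x = singularHomology.map ℤ ℤ d.jAC 2 y + singularHomology.map ℤ ℤ d.jBC 2 z := by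
  -- Mayer–Vietoris: `ψ : H₂(U) ⊕ H₂(V) → H₂(P)` is onto since `H₁(U ∩ V) = H₁(S³) = 0`
  have hint : interior (range d.jA) ∪ interior (range d.jB) = univ := by
    rw [d.isOpen_range_jA.interior_eq, d.isOpen_range_jB.interior_eq, d.union_range]
  have hexc := relativeSingularHomology.isIso_map_of_interior_union_interior_holds ℤ ℤ P
  have h₀ : IsZero (singularHomology ℤ ℤ ↥(range d.jA ∩ range d.jB) 1) :=
    (isZero_singularHomology_complZero 3 (by norm_num) Nat.one_pos (by norm_num)).of_iso
      (singularHomology.mapIso ℤ ℤ d.neckHomeomorph.symm 1)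
  haveI : Epi (mayerVietoris.ψ ℤ ℤ (range d.jA) (range d.jB) 2) :=
    (mayerVietoris.exact₂_holds ℤ ℤ (range d.jA) (range d.jB) hexc hint 1).epi_f (h₀.eq_of_tgt _ _)
  obtain ⟨w, hw⟩ := (ModuleCat.epi_iff_surjective _).1
    (inferInstance : Epi (mayerVietoris.ψ ℤ ℤ (range d.jA) (range d.jB) 2)) x
  set u := (biprod.fst : singularHomology ℤ ℤ ↥(range d.jA) 2 ⊞
    singularHomology ℤ ℤ ↥(range d.jB) 2 ⟶ _) w
  set v := (biprod.snd : singularHomology ℤ ℤ ↥(range d.jA) 2 ⊞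
    singularHomology ℤ ℤ ↥(range d.jB) 2 ⟶ _) w
  have hw' : mayerVietoris.ψ ℤ ℤ (range d.jA) (range d.jB) 2 w =
      singularHomology.map ℤ ℤ (subsetIncl (range d.jA)) 2 u +
        singularHomology.map ℤ ℤ (subsetIncl (range d.jB)) 2 v :=
    biprod_desc_apply _ _ w
  -- the pieces are the punctured summands
  let eA : puncture d.i₁ ≃ₜ ↥(range d.jA) := d.isEmbedding_jA.toHomeomorph
  let eB : puncture d.i₂ ≃ₜ ↥(range d.jB) := d.isEmbedding_jB.toHomeomorph
  have hceA : d.jAC.comp (eA.symm : C(↥(range d.jA), puncture d.i₁)) = subsetIncl (range d.jA) := by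
    ext p
    have h := congrArg (fun f : C(puncture d.i₁, P) => f (eA.symm p)) d.jAC_eq_comp
    simp only [ContinuousMap.comp_apply] at h
    show d.jAC (eA.symm p) = _
    rw [h]
    show ((eA (eA.symm p) : ↥(range d.jA)) : P) = (p : P)
    rw [eA.apply_symm_apply]
  have hceB : d.jBC.comp (eB.symm : C(↥(range d.jB), puncture d.i₂)) = subsetIncl (range d.jB) := by
    ext p
    have h := congrArg (fun f : C(puncture d.i₂, P) => f (eB.symm p)) d.jBC_eq_comp
    simp only [ContinuousMap.comp_apply] at h
    show d.jBC (eB.symm p) = _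
    rw [h]
    show ((eB (eB.symm p) : ↥(range d.jB)) : P) = (p : P)
    rw [eB.apply_symm_apply]
  have hA : ∀ u', singularHomology.map ℤ ℤ d.jAC 2
      (singularHomology.map ℤ ℤ (eA.symm : C(↥(range d.jA), puncture d.i₁)) 2 u') =
      singularHomology.map ℤ ℤ (subsetIncl (range d.jA)) 2 u' := fun u' => by
    rw [← ModuleCat.comp_apply, ← singularHomology.map_comp, hceA]
  have hB : ∀ v', singularHomology.map ℤ ℤ d.jBC 2
      (singularHomology.map ℤ ℤ (eB.symm : C(↥(range d.jB), puncture d.i₂)) 2 v') =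
      singularHomology.map ℤ ℤ (subsetIncl (range d.jB)) 2 v' := fun v' => by
    rw [← ModuleCat.comp_apply, ← singularHomology.map_comp, hceB]
  refine ⟨singularHomology.map ℤ ℤ (eA.symm : C(↥(range d.jA), puncture d.i₁)) 2 u,
    singularHomology.map ℤ ℤ (eB.symm : C(↥(range d.jB), puncture d.i₂)) 2 v, ?_⟩
  rw [hA, hB, ← hw', hw]

variable [T2Space P]

/-- **`(c_M ∘ jB)_* = 0` on `Hₖ`, `k ≠ 0`**: restricted to the second piece the collapse map factors
through the contractible closed disc `i₁ (B̄)` (`collapseLeft_jB_mem`; homological companion of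
the tree's `map_jBC_map_collapseLeft`). [cite: HatcherAT2002, §2.1 Prop. 2.8 and Ch. 0 p. 4] -/
theorem map_collapseLeft_comp_jBC_eq_zero [CompactSpace M] {k : ℕ} (hk : k ≠ 0) :
    singularHomology.map ℤ ℤ (d.collapseLeft.comp d.jBC) k = 0 := by
  set K : Set M := d.i₁ '' closedBall (0 : 𝔼 (3 + 1)) 1
  haveI : ContractibleSpace ↥K := d.contractibleSpace_image_closedBall
  let r : C(puncture d.i₂, ↥K) :=
    ⟨fun b => ⟨d.collapseLeft (d.jB b), d.collapseLeft_jB_mem b⟩,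
      (d.collapseLeft.continuous.comp d.isEmbedding_jB.continuous).subtype_mk _⟩
  have hfac : d.collapseLeft.comp d.jBC = (subsetIncl K).comp r := by ext b; rfl
  rw [hfac, singularHomology.map_comp]
  have h0 : IsZero (singularHomology ℤ ℤ (↥K) k) :=
    isZero_singularHomology_of_contractibleSpace ℤ ℤ (X := ↥K) hk
  rw [h0.eq_of_src (singularHomology.map ℤ ℤ (subsetIncl K) k) 0, comp_zero]

/-- **`(c_N ∘ jA)_* = 0` on `Hₖ`, `k ≠ 0`.** [cite: HatcherAT2002, §2.1 Prop. 2.8 and Ch. 0 p. 4] -/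
theorem map_collapseRight_comp_jAC_eq_zero [CompactSpace N] {k : ℕ} (hk : k ≠ 0) :
    singularHomology.map ℤ ℤ (d.collapseRight.comp d.jAC) k = 0 :=
  d.swap.map_collapseLeft_comp_jBC_eq_zero hk

/-- **`⟨c_M^* a, jA_* y⟩ = ⟨a, ι_* y⟩`** (`ι : M ∖ {pt} ⊆ M`): naturality of the Kronecker
pairing and `c_M ∘ jA = ι`. [cite: HatcherAT2002, §3.1 p. 201] -/
theorem freeKroneckerPairing_map_collapseLeft_map_jAC [CompactSpace M] {k : ℕ}
    (a : freeCohomology ℤ M k) (y : singularHomology ℤ ℤ (puncture d.i₁) k) :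
    freeKroneckerPairing P k (freeCohomology.map d.collapseLeft k a)
        (singularHomology.map ℤ ℤ d.jAC k y) =
      freeKroneckerPairing M k a
        (singularHomology.map ℤ ℤ (HomologicalOrientation.valC (puncture d.i₁)) k y) := by
  have h : freeCohomology.map d.jAC k (freeCohomology.map d.collapseLeft k a) =
      freeCohomology.map (HomologicalOrientation.valC (puncture d.i₁)) k a := by
    rw [← d.collapseLeft_comp_jAC, freeCohomology.map_comp]
    rfl
  rw [← freeKroneckerPairing_map, h, freeKroneckerPairing_map]

/-- **`⟨c_M^* a, jB_* z⟩ = 0`** in positive degree. [cite: HatcherAT2002, §3.1 p. 201] -/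
theorem freeKroneckerPairing_map_collapseLeft_map_jBC [CompactSpace M] {k : ℕ} (hk : k ≠ 0)
    (a : freeCohomology ℤ M k) (z : singularHomology ℤ ℤ (puncture d.i₂) k) :
    freeKroneckerPairing P k (freeCohomology.map d.collapseLeft k a)
        (singularHomology.map ℤ ℤ d.jBC k z) = 0 := by
  have h : freeCohomology.map d.jBC k (freeCohomology.map d.collapseLeft k a) =
      freeCohomology.map (d.collapseLeft.comp d.jBC) k a := by
    rw [freeCohomology.map_comp]
    rfl
  rw [← freeKroneckerPairing_map, h, freeKroneckerPairing_map, d.map_collapseLeft_comp_jBC_eq_zero hk]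
  simp

/-- **`⟨c_N^* b, jB_* z⟩ = ⟨b, ι_* z⟩`.** [cite: HatcherAT2002, §3.1 p. 201] -/
theorem freeKroneckerPairing_map_collapseRight_map_jBC [CompactSpace N] {k : ℕ}
    (b : freeCohomology ℤ N k) (z : singularHomology ℤ ℤ (puncture d.i₂) k) :
    freeKroneckerPairing P k (freeCohomology.map d.collapseRight k b)
        (singularHomology.map ℤ ℤ d.jBC k z) =
      freeKroneckerPairing N k b
        (singularHomology.map ℤ ℤ (HomologicalOrientation.valC (puncture d.i₂)) k z) :=
  d.swap.freeKroneckerPairing_map_collapseLeft_map_jAC b z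

/-- **`⟨c_N^* b, jA_* y⟩ = 0`** in positive degree. [cite: HatcherAT2002, §3.1 p. 201] -/
theorem freeKroneckerPairing_map_collapseRight_map_jAC [CompactSpace N] {k : ℕ} (hk : k ≠ 0)
    (b : freeCohomology ℤ N k) (y : singularHomology ℤ ℤ (puncture d.i₁) k) :
    freeKroneckerPairing P k (freeCohomology.map d.collapseRight k b)
        (singularHomology.map ℤ ℤ d.jAC k y) = 0 :=
  d.swap.freeKroneckerPairing_map_collapseLeft_map_jBC hk b y

end ConnectedSumNeck

/-! ### §A′ Filling a puncture of a 4-manifold does not change `H₂` -/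

/-- **`H₂(M ∖ {pt}; ℤ) ≅ H₂(M; ℤ)` for a topological 4-manifold** (exact sequence of the pair with
the local homology `Hⱼ(M | pt) = 0`, `j = 2, 3`; Hatcher 2002, Thm. 2.16 and §3.3 p. 231).
[cite: HatcherAT2002, Thm. 2.16 and §3.3 p. 231] -/
theorem isIso_map_valC_puncture {M X : Type} [TopologicalSpace M] [T2Space M]
    [ChartedSpace (𝔼 4) M] [Zero X] (i : X → M) :
    IsIso (singularHomology.map ℤ ℤ (HomologicalOrientation.valC (puncture i)) 2) :=
  isIso_map_subsetIncl_compl_singleton (i 0) 1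
    (isZero_localHomology_of_ne (n := 4) ℤ ℤ (i 0) (by norm_num))
    (isZero_localHomology_of_ne (n := 4) ℤ ℤ (i 0) (by norm_num))

/-! ### §B The lattice of `S² × S²`: the hyperbolic basis and the fibre class -/

namespace SphereProd

/-- Local notation: `Q⟦μ⟧` is the intersection form on `H²(·; ℤ)/T`. -/
local notation "Q⟦" μ "⟧" =>
  Literature.AlgebraicTopology.SingularHomology.intersectionForm two_add_two_eq_four μ

/-- The chosen basis `ḡ₀, ḡ₁` of `H²(S² × S²; ℤ)/T` (`exists_basis_freeCohomology`). [folklore] -/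
abbrev gBasis : Module.Basis (Fin 2) ℤ ↥(freeCohomology ℤ ((𝕊 2) × (𝕊 2)) 2) :=
  (exists_basis_freeCohomology (k := 2) le_rfl).choose

/-- `gBasis a = [g a]`. [folklore] -/
theorem gBasis_apply (a : Fin 2) : gBasis a = freeCohomology.mk (g (k := 2) le_rfl a) :=
  (exists_basis_freeCohomology (k := 2) le_rfl).choose_spec a

/-- **`hyperbolicIsometryEquiv` sends `f = (1, 0)` to `ḡ₀ = [pr₁^* γ]`** (the class killing the
fibres `{p} × S²`). [cite: HatcherAT2002, Example 3.11] -/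
theorem hyperbolicIsometryEquiv_single_zero (μ : HomologicalOrientation ℤ ((𝕊 2) × (𝕊 2)) 4) :
    hyperbolicIsometryEquiv μ (Pi.single 0 1) = gBasis 0 := by
  change gBasis.equivFun.symm (signTwist _ _ (Pi.single 0 1)) = _
  simp only [Module.Basis.equivFun_symm_apply, signTwist_apply, Fin.sum_univ_two,
    Matrix.cons_val_zero, Matrix.cons_val_one, Matrix.cons_val_fin_one, Pi.single_eq_same,
    Pi.single_eq_of_ne (one_ne_zero (α := Fin 2)), mul_zero]
  -- the `ℤ`-module structure of the lattice is the `ModuleCat` one; normalise with `module`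
  module

/-- `⟨ḡ₀, y₁⟩ = 0`: `ḡ₀ = [pr₁^* γ]` kills the fibre class. [cite: HatcherAT2002, Example 3.11] -/
theorem freeKroneckerPairing_gBasis_zero_y_one :
    freeKroneckerPairing ((𝕊 2) × (𝕊 2)) 2 (gBasis 0) (y (k := 2) le_rfl 1) = 0 := by
  rw [gBasis_apply, freeKroneckerPairing_mk, kroneckerPairing_g_y_of_ne le_rfl (by decide)]

/-- `⟨ḡ₁, y₁⟩ = 1`. [cite: HatcherAT2002, Example 3.11] -/
theorem freeKroneckerPairing_gBasis_one_y_one :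
    freeKroneckerPairing ((𝕊 2) × (𝕊 2)) 2 (gBasis 1) (y (k := 2) le_rfl 1) = 1 := by
  rw [gBasis_apply, freeKroneckerPairing_mk, kroneckerPairing_g_y_self]

/-- `⟨ḡ₀, y₀⟩ = 1`. [cite: HatcherAT2002, Example 3.11] -/
theorem freeKroneckerPairing_gBasis_zero_y_zero :
    freeKroneckerPairing ((𝕊 2) × (𝕊 2)) 2 (gBasis 0) (y (k := 2) le_rfl 0) = 1 := by
  rw [gBasis_apply, freeKroneckerPairing_mk, kroneckerPairing_g_y_self]

/-- `⟨ḡ₁, y₀⟩ = 0`. [cite: HatcherAT2002, Example 3.11] -/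
theorem freeKroneckerPairing_gBasis_one_y_zero :
    freeKroneckerPairing ((𝕊 2) × (𝕊 2)) 2 (gBasis 1) (y (k := 2) le_rfl 0) = 0 := by
  rw [gBasis_apply, freeKroneckerPairing_mk, kroneckerPairing_g_y_of_ne le_rfl (by decide)]

/-- **`⟨Θ_S v, y₁⟩ = x v₁`** for the fibre class `y₁ = ι₂₊[S²]`, with the sign
`x = Q (ḡ₀, ḡ₁) = ±1` of `hyperbolicIsometryEquiv`: `Θ_S v = v₀ ḡ₀ + x v₁ ḡ₁` and
`⟨ḡₐ, y_b⟩ = δ_{ab}`. [cite: HatcherAT2002, Example 3.11] -/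
theorem freeKroneckerPairing_hyperbolicIsometryEquiv_y_one
    (μ : HomologicalOrientation ℤ ((𝕊 2) × (𝕊 2)) 4) (v : Fin 2 → ℤ) :
    freeKroneckerPairing ((𝕊 2) × (𝕊 2)) 2 (hyperbolicIsometryEquiv μ v) (y (k := 2) le_rfl 1) =
      Q⟦μ⟧ (gBasis 0) (gBasis 1) * v 1 := by
  change freeKroneckerPairing ((𝕊 2) × (𝕊 2)) 2 (gBasis.equivFun.symm (signTwist _ _ v))
    (y (k := 2) le_rfl 1) = _
  simp only [Module.Basis.equivFun_symm_apply, signTwist_apply, Fin.sum_univ_two,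
    Matrix.cons_val_zero, Matrix.cons_val_one, Matrix.cons_val_fin_one, map_add, map_smul,
    LinearMap.add_apply, LinearMap.smul_apply, freeKroneckerPairing_gBasis_zero_y_one,
    freeKroneckerPairing_gBasis_one_y_one, smul_eq_mul, mul_zero, mul_one, zero_add]

/-- The sign `x = Q (ḡ₀, ḡ₁)` satisfies `x² = 1`. [cite: HatcherAT2002, Example 3.11] -/
theorem intersectionForm_gBasis_mul_self (μ : HomologicalOrientation ℤ ((𝕊 2) × (𝕊 2)) 4) :
    Q⟦μ⟧ (gBasis 0) (gBasis 1) * Q⟦μ⟧ (gBasis 0) (gBasis 1) = 1 := by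
  have habs : |Q⟦μ⟧ (gBasis 0) (gBasis 1)| = 1 := by
    rw [gBasis_apply, gBasis_apply, intersectionForm_mk_mk]
    exact abs_cupPairing_g (k := 2) le_rfl μ
  rcases abs_eq (zero_le_one' ℤ) |>.1 habs with h | h <;> rw [h] <;> norm_num

/-- **`⟨ḡₐ, y_b⟩ = δ_{ab}`** on cohomology modulo torsion. [cite: HatcherAT2002, Example 3.11] -/
theorem freeKroneckerPairing_gBasis_y (a b : Fin 2) :
    freeKroneckerPairing ((𝕊 2) × (𝕊 2)) 2 (gBasis a) (y (k := 2) le_rfl b) =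
      if a = b then 1 else 0 := by
  rw [gBasis_apply, freeKroneckerPairing_mk, kroneckerPairing_g_y]

/-- **A class of `H₂(S² × S²)` killed by `ḡ₀` is a multiple of the fibre class `y₁ = ι₂₊[S²]`**,
namely `⟨ḡ₁, z⟩ • y₁` (`H₂ = ℤ y₀ ⊕ ℤ y₁` with `⟨ḡₐ, y_b⟩ = δ_{ab}`). [cite: HatcherAT2002, Example 3.11] -/
theorem eq_smul_y_one_of_freeKroneckerPairing_gBasis_zero
    (z : singularHomology ℤ ℤ ((𝕊 2) × (𝕊 2)) 2)
    (hz : freeKroneckerPairing ((𝕊 2) × (𝕊 2)) 2 (gBasis 0) z = 0) :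
    z = freeKroneckerPairing ((𝕊 2) × (𝕊 2)) 2 (gBasis 1) z • y (k := 2) le_rfl 1 := by
  obtain ⟨c, rfl⟩ := exists_eq_sum_smul_y (k := 2) le_rfl z
  simp only [map_add, map_zsmul, freeKroneckerPairing_gBasis_zero_y_one,
    freeKroneckerPairing_gBasis_zero_y_zero, smul_eq_mul, mul_one, mul_zero, add_zero] at hz
  simp only [hz, zero_smul, zero_add, map_zsmul, freeKroneckerPairing_gBasis_one_y_one,
    smul_eq_mul, mul_one]

/-- **All vertical slices `v ↦ (p, v)` carry `[S²]` to the fibre class `y₁`** (they are homotopic,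
`S²` being path connected). [cite: HatcherAT2002, Example 3.11] -/
theorem map_vertSlice_fundamentalClass (p : 𝕊 2) :
    singularHomology.map ℤ ℤ (⟨fun v => (p, v), by fun_prop⟩ : C(𝕊 2, (𝕊 2) × (𝕊 2))) 2
        (μS (k := 2) le_rfl).fundamentalClass = y (k := 2) le_rfl 1 := by
  rw [singularHomology.map_eq_of_homotopic ℤ ℤ (homotopic_vertSlice (k := 2) (by norm_num) p
    (southPole 2)) 2]
  rfl

end SphereProd

/-! ### §C Lattice bookkeeping for one more hyperbolic summand -/

section Algebra

variable {A B C D V : Type*} [AddCommGroup A] [AddCommGroup B] [AddCommGroup C] [AddCommGroup D]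
  [AddCommGroup V]

/-- **Splitting off the new coordinate**: from `Θ' : A × Vᵏ ≅ B`, `Θ_S : V ≅ C` and `Φ : B × C ≅ D`
the additive equivalence `Θ : A × Vᵏ⁺¹ ≅ D`, `Θ (a, c) = Φ (Θ' (a, tail c), Θ_S (c 0))`.
[folklore] -/
theorem exists_addEquiv_cons {k : ℕ} (Θ' : (A × (Fin k → V)) ≃+ B) (ΘS : V ≃+ C)
    (Φ : (B × C) ≃+ D) :
    ∃ Θ : (A × (Fin (k + 1) → V)) ≃+ D, ∀ a c, Θ (a, c) = Φ (Θ' (a, Fin.tail c), ΘS (c 0)) := by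
  refine ⟨{ toFun := fun p => Φ (Θ' (p.1, Fin.tail p.2), ΘS (p.2 0))
            invFun := fun d => ((Θ'.symm (Φ.symm d).1).1,
              Fin.cons (ΘS.symm (Φ.symm d).2) (Θ'.symm (Φ.symm d).1).2)
            left_inv := fun p => ?_
            right_inv := fun d => ?_
            map_add' := fun p q => ?_ }, fun a c => rfl⟩
  · simp only [AddEquiv.symm_apply_apply, Prod.mk.eta, Fin.cons_self_tail]
  · simp only [Fin.tail_cons, Fin.cons_zero, Prod.mk.eta, AddEquiv.apply_symm_apply]
  · have htail : Fin.tail (p + q).2 = Fin.tail p.2 + Fin.tail q.2 := rfl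
    rw [htail, Prod.snd_add, Prod.fst_add, Pi.add_apply, ← map_add Φ, Prod.mk_add_mk, ← map_add Θ',
      Prod.mk_add_mk, ← map_add ΘS]

/-- `tail (single 0 v) = 0` on `Fin (k + 1)`. [folklore] -/
theorem tail_single_zero {k : ℕ} (v : V) :
    Fin.tail (Pi.single (M := fun _ : Fin (k + 1) => V) 0 v) = 0 := by
  funext j
  simp [Fin.tail, Fin.succ_ne_zero]

/-- `tail (single (succ i) v) = single i v`. [folklore] -/
theorem tail_single_succ {k : ℕ} (i : Fin k) (v : V) :
    Fin.tail (Pi.single (M := fun _ : Fin (k + 1) => V) i.succ v) = Pi.single i v := by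
  funext j
  simp [Fin.tail, Pi.single_apply, Fin.succ_inj]

/-- `single (succ i) v 0 = 0`. [folklore] -/
theorem single_succ_apply_zero {k : ℕ} (i : Fin k) (v : V) :
    (Pi.single (M := fun _ : Fin (k + 1) => V) i.succ v) 0 = 0 := by
  simp [(Fin.succ_ne_zero i).symm]

end Algebra


/-! ### §D One stabilisation step: the homological bookkeeping -/

section Step

/-- Local notation: `Q⟦μ⟧` is the intersection form on `H²(·; ℤ)/T`. -/
local notation "Q⟦" μ "⟧" =>
  Literature.AlgebraicTopology.SingularHomology.intersectionForm two_add_two_eq_four μ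

variable {X M' P : Type} [TopologicalSpace X] [TopologicalSpace M'] [T2Space M']
  [ChartedSpace (𝔼 4) M'] [CompactSpace M'] [TopologicalSpace P] [T2Space P]
  [ChartedSpace (𝔼 4) X] [ChartedSpace (𝔼 4) P]

omit [T2Space M'] [CompactSpace M'] [T2Space P] in
/-- **`H₂` of the top of a composite is onto when both tops are** (`H₁` of the middle vanishing):
Mayer–Vietoris surjectivity `H₂(W') ⊕ H₂(W₁) → H₂(W)` combined with `H₂(M') → H₂(W')`,
`H₂(P) → H₂(W₁)` onto and the seam `e₁ ∘ inr' = e₂ ∘ inl₁`. [cite: Kirby1989, Ch. X, p. 56] -/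
theorem epi_map_inr_of_pieces (E' : Cobordism 4 X M') (E₁ : Cobordism 4 M' P) (E : Cobordism 4 X P)
    (e₁ : C(E'.W, E.W)) (e₂ : C(E₁.W, E.W))
    (hseam : ∀ y, e₁ (E'.inr y) = e₂ (E₁.inl y)) (hinr : ∀ p, E.inr p = e₂ (E₁.inr p))
    [Epi (biprod.desc (singularHomology.map ℤ ℤ e₁ 2) (singularHomology.map ℤ ℤ e₂ 2))]
    (hepi' : Epi (singularHomology.map ℤ ℤ (⟨E'.inr, E'.continuous_inr⟩ : C(M', E'.W)) 2))
    (hepi₁ : Epi (singularHomology.map ℤ ℤ (⟨E₁.inr, E₁.continuous_inr⟩ : C(P, E₁.W)) 2)) :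
    Epi (singularHomology.map ℤ ℤ (⟨E.inr, E.continuous_inr⟩ : C(P, E.W)) 2) := by
  rw [ModuleCat.epi_iff_surjective]
  intro z
  obtain ⟨a, c, rfl⟩ := Cobordism.exists_add_eq_of_epi_biprodDesc (singularHomology.map ℤ ℤ e₁ 2)
    (singularHomology.map ℤ ℤ e₂ 2) z
  obtain ⟨m, rfl⟩ := (ModuleCat.epi_iff_surjective _).1 hepi' a
  have hseamE : e₁.comp ⟨E'.inr, E'.continuous_inr⟩ = e₂.comp ⟨E₁.inl, E₁.continuous_inl⟩ := by
    ext y; exact hseam y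
  have hinrE : (⟨E.inr, E.continuous_inr⟩ : C(P, E.W)) = e₂.comp ⟨E₁.inr, E₁.continuous_inr⟩ := by
    ext p; exact hinr p
  have h1 : singularHomology.map ℤ ℤ e₁ 2 (singularHomology.map ℤ ℤ
      (⟨E'.inr, E'.continuous_inr⟩ : C(M', E'.W)) 2 m) =
      singularHomology.map ℤ ℤ e₂ 2 (singularHomology.map ℤ ℤ
        (⟨E₁.inl, E₁.continuous_inl⟩ : C(M', E₁.W)) 2 m) := by
    rw [← ModuleCat.comp_apply, ← singularHomology.map_comp, hseamE, singularHomology.map_comp,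
      ModuleCat.comp_apply]
  obtain ⟨p, hp⟩ := (ModuleCat.epi_iff_surjective _).1 hepi₁
    (singularHomology.map ℤ ℤ (⟨E₁.inl, E₁.continuous_inl⟩ : C(M', E₁.W)) 2 m + c)
  refine ⟨p, ?_⟩
  rw [hinrE, singularHomology.map_comp, ModuleCat.comp_apply, hp, map_add, h1]

variable (d : ConnectedSumNeck 4 M' ((𝕊 2) × (𝕊 2)) P)

set_option maxHeartbeats 800000 in
/-- **The homological bookkeeping of one stabilisation step** (Kirby 1989, Ch. X, proof of Thm. 1,
pp. 55–56: the 2-handles are attached along trivial circles with trivial framing; a new 2-handle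
kills nothing of `H₂(M')` and its belt sphere bounds in the trace).  Let `E = E' ∪_{M'} E₁` be a
composite (pieces `e₁`, `e₂`, seam, ends) of a cobordism `E' : X ~ M'` with a cobordism
`E₁ : M' ~ P = M' # S² × S²` obeying the cylinder law `(inr₁ ∘ jA)_* = (inl₁ ∘ ι)_*` and the belt
law `(inr₁ ∘ jB ∘ s)_* = 0` for the fibre sphere `s` of the new summand; let `b'ⱼ ∈ H₂(M')`,
`β'ⱼ ∈ H²(M')/T` be classes with `inr'_* b'ⱼ = 0`, `⟨γ, b'ⱼ⟩ = ε'ⱼ Q_{M'}(γ, β'ⱼ)` and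
"`⟨β'ⱼ, x⟩ = 0 ∀ j ⇒ inr'_* x ∈ im inl'_*`"; let `Φ (a, c) = c_{M'}^* a + c_S^* c` split the form of
`P` as `Q_{M'} ⊥ Q_S`, and put `β₀ = Φ (0, ḡ₀)` (`ḡ₀ = Θ_S (1, 0)`), `βⱼ₊₁ = Φ (β'ⱼ, 0)`. Then with
`b₀ = jB_* s_* [S²]` (the belt sphere) and `bⱼ₊₁ = jA_* b'ⱼ` (lifted to the punctured `M'`):
`inr_* bⱼ = 0`; `⟨βⱼ, x⟩ = 0 ∀ j ⇒ inr_* x ∈ im inl_*`; and `⟨γ, b_l⟩ = ε_l Q_P(γ, β_l)` with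
`ε₀ = Q_S(ḡ₀, ḡ₁) = ±1`, `εⱼ₊₁ = ε'ⱼ`.  (Mayer–Vietoris along the neck, naturality of the
Kronecker pairing under the collapse maps, `H₂(S² × S²) = ℤ y₀ ⊕ ℤ y₁` with `⟨ḡₐ, y_b⟩ = δ_{ab}`,
and `H₂(N ∖ pt) ≅ H₂(N)` for 4-manifolds.) [cite: Kirby1989, Ch. X, proof of Thm. 1, pp. 55–56] [cite: WallJLMS1964, §2 pp. 145–146] -/
theorem step_homology {k : ℕ} (E' : Cobordism 4 X M') (E₁ : Cobordism 4 M' P) (E : Cobordism 4 X P)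
    (e₁ : C(E'.W, E.W)) (e₂ : C(E₁.W, E.W))
    (hseam : ∀ y, e₁ (E'.inr y) = e₂ (E₁.inl y)) (hinr : ∀ p, E.inr p = e₂ (E₁.inr p))
    (hinl : (⟨E.inl, E.continuous_inl⟩ : C(X, E.W)).Homotopic (e₁.comp ⟨E'.inl, E'.continuous_inl⟩))
    (s : C(𝕊 2, ↥(puncture d.i₂))) (p₀ : 𝕊 2)
    (hs : ∀ v, ((s v : ↥(puncture d.i₂)) : (𝕊 2) × (𝕊 2)) = (p₀, v))
    (hcyl : ∀ j, singularHomology.map ℤ ℤ ((⟨E₁.inr, E₁.continuous_inr⟩ : C(P, E₁.W)).comp d.jAC) j =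
      singularHomology.map ℤ ℤ ((⟨E₁.inl, E₁.continuous_inl⟩ : C(M', E₁.W)).comp
        (HomologicalOrientation.valC (puncture d.i₁))) j)
    (hbelt : singularHomology.map ℤ ℤ ((⟨E₁.inr, E₁.continuous_inr⟩ : C(P, E₁.W)).comp
      (d.jBC.comp s)) 2 = 0)
    (b' : Fin k → singularHomology ℤ ℤ M' 2) (β' : Fin k → freeCohomology ℤ M' 2) (ε' : Fin k → ℤ)
    (μM' : HomologicalOrientation ℤ M' 4) (μS' : HomologicalOrientation ℤ ((𝕊 2) × (𝕊 2)) 4)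
    (μP : HomologicalOrientation ℤ P 4)
    (hP1' : ∀ j, singularHomology.map ℤ ℤ (⟨E'.inr, E'.continuous_inr⟩ : C(M', E'.W)) 2 (b' j) = 0)
    (hP2' : ∀ x : singularHomology ℤ ℤ M' 2, (∀ j, freeKroneckerPairing M' 2 (β' j) x = 0) →
      ∃ w : singularHomology ℤ ℤ X 2,
        singularHomology.map ℤ ℤ (⟨E'.inr, E'.continuous_inr⟩ : C(M', E'.W)) 2 x =
          singularHomology.map ℤ ℤ (⟨E'.inl, E'.continuous_inl⟩ : C(X, E'.W)) 2 w)
    (hP3' : ∀ (γ : freeCohomology ℤ M' 2) (l : Fin k),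
      freeKroneckerPairing M' 2 γ (b' l) = ε' l * Q⟦μM'⟧ γ (β' l))
    (Φ : (↥(freeCohomology ℤ M' 2) × ↥(freeCohomology ℤ ((𝕊 2) × (𝕊 2)) 2)) ≃+ ↥(freeCohomology ℤ P 2))
    (hΦapply : ∀ ac, Φ ac = freeCohomology.map d.collapseLeft 2 ac.1 +
      freeCohomology.map d.collapseRight 2 ac.2)
    (hΦ : ∀ x y, Q⟦μP⟧ (Φ x) (Φ y) = Q⟦μM'⟧ x.1 y.1 + Q⟦μS'⟧ x.2 y.2)
    (β : Fin (k + 1) → freeCohomology ℤ P 2)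
    (hβ0 : β 0 = Φ (0, SphereProd.hyperbolicIsometryEquiv μS' (Pi.single 0 1)))
    (hβs : ∀ i, β i.succ = Φ (β' i, 0)) :
    ∃ b : Fin (k + 1) → singularHomology ℤ ℤ P 2,
      (∀ j, singularHomology.map ℤ ℤ (⟨E.inr, E.continuous_inr⟩ : C(P, E.W)) 2 (b j) = 0) ∧
      (∀ x : singularHomology ℤ ℤ P 2, (∀ j, freeKroneckerPairing P 2 (β j) x = 0) →
        ∃ w : singularHomology ℤ ℤ X 2,
          singularHomology.map ℤ ℤ (⟨E.inr, E.continuous_inr⟩ : C(P, E.W)) 2 x =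
            singularHomology.map ℤ ℤ (⟨E.inl, E.continuous_inl⟩ : C(X, E.W)) 2 w) ∧
      (∀ (γ : freeCohomology ℤ P 2) (l : Fin (k + 1)),
        freeKroneckerPairing P 2 γ (b l) =
          (Fin.cons (Q⟦μS'⟧ (SphereProd.gBasis 0) (SphereProd.gBasis 1)) ε' : Fin (k + 1) → ℤ) l *
            Q⟦μP⟧ γ (β l)) := by
  classical
  letI : ChartedSpace (𝔼 4) ((𝕊 2) × (𝕊 2)) := SphereProd.chartedSpace 2
  -- the six structure maps, as continuous maps
  set inrE : C(P, E.W) := ⟨E.inr, E.continuous_inr⟩ with hinrE_def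
  set inlE : C(X, E.W) := ⟨E.inl, E.continuous_inl⟩ with hinlE_def
  set inr₁ : C(P, E₁.W) := ⟨E₁.inr, E₁.continuous_inr⟩ with hinr₁_def
  set inl₁ : C(M', E₁.W) := ⟨E₁.inl, E₁.continuous_inl⟩ with hinl₁_def
  set inr' : C(M', E'.W) := ⟨E'.inr, E'.continuous_inr⟩ with hinr'_def
  set inl' : C(X, E'.W) := ⟨E'.inl, E'.continuous_inl⟩ with hinl'_def
  -- filling the punctures
  obtain ⟨vA, hvA_def⟩ : ∃ vA : singularHomology ℤ ℤ ↥(puncture d.i₁) 2 ⟶ singularHomology ℤ ℤ M' 2,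
      vA = singularHomology.map ℤ ℤ (HomologicalOrientation.valC (puncture d.i₁)) 2 := ⟨_, rfl⟩
  obtain ⟨vB, hvB_def⟩ : ∃ vB : singularHomology ℤ ℤ ↥(puncture d.i₂) 2 ⟶
      singularHomology ℤ ℤ ((𝕊 2) × (𝕊 2)) 2,
      vB = singularHomology.map ℤ ℤ (HomologicalOrientation.valC (puncture d.i₂)) 2 := ⟨_, rfl⟩
  haveI hvAiso : IsIso vA := by rw [hvA_def]; exact isIso_map_valC_puncture d.i₁
  haveI hvBiso : IsIso vB := by rw [hvB_def]; exact isIso_map_valC_puncture d.i₂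
  have hvA : ∀ z, vA (inv vA z) = z := fun z => by
    rw [← ModuleCat.comp_apply, IsIso.inv_hom_id, ModuleCat.id_apply]
  have hvBinj : Function.Injective vB :=
    ((ConcreteCategory.isIso_iff_bijective vB).1 inferInstance).1
  -- the fibre sphere of the new summand and its class
  obtain ⟨σS, hσS⟩ : ∃ σS : singularHomology ℤ ℤ (𝕊 2) 2,
      σS = (SphereProd.μS (k := 2) le_rfl).fundamentalClass := ⟨_, rfl⟩
  have hslice : (HomologicalOrientation.valC (puncture d.i₂)).comp s =
      (⟨fun v => (p₀, v), by fun_prop⟩ : C(𝕊 2, (𝕊 2) × (𝕊 2))) := by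
    ext v <;> simp [hs v]
  have hy1 : vB (singularHomology.map ℤ ℤ s 2 σS) = SphereProd.y (k := 2) le_rfl 1 := by
    rw [hvB_def, ← ModuleCat.comp_apply, ← singularHomology.map_comp, hslice, hσS]
    exact SphereProd.map_vertSlice_fundamentalClass p₀
  -- map identities from the composite
  have hinrE : inrE = e₂.comp inr₁ := by ext p; exact hinr p
  have hseamE : e₁.comp inr' = e₂.comp inl₁ := by ext y; exact hseam y
  have hinlE : ∀ w, singularHomology.map ℤ ℤ inlE 2 w =
      singularHomology.map ℤ ℤ e₁ 2 (singularHomology.map ℤ ℤ inl' 2 w) := fun w => by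
    rw [singularHomology.map_eq_of_homotopic ℤ ℤ hinl 2, singularHomology.map_comp,
      ModuleCat.comp_apply]
  -- pushing the two pieces of `P` into `E`
  have hA : ∀ y, singularHomology.map ℤ ℤ inrE 2 (singularHomology.map ℤ ℤ d.jAC 2 y) =
      singularHomology.map ℤ ℤ e₁ 2 (singularHomology.map ℤ ℤ inr' 2 (vA y)) := fun y => by
    have h1 : singularHomology.map ℤ ℤ inrE 2 (singularHomology.map ℤ ℤ d.jAC 2 y) =
        singularHomology.map ℤ ℤ e₂ 2 (singularHomology.map ℤ ℤ (inr₁.comp d.jAC) 2 y) := by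
      rw [hinrE, singularHomology.map_comp, singularHomology.map_comp, ModuleCat.comp_apply,
        ModuleCat.comp_apply]
    have h2 : singularHomology.map ℤ ℤ e₂ 2 (singularHomology.map ℤ ℤ
        (inl₁.comp (HomologicalOrientation.valC (puncture d.i₁))) 2 y) =
        singularHomology.map ℤ ℤ (e₂.comp inl₁) 2 (vA y) := by
      rw [hvA_def, singularHomology.map_comp, singularHomology.map_comp, ModuleCat.comp_apply,
        ModuleCat.comp_apply]
    rw [h1, hcyl 2, h2, ← hseamE, singularHomology.map_comp, ModuleCat.comp_apply]
  have hB : singularHomology.map ℤ ℤ inrE 2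
      (singularHomology.map ℤ ℤ d.jBC 2 (singularHomology.map ℤ ℤ s 2 σS)) = 0 := by
    have h3 : singularHomology.map ℤ ℤ inr₁ 2
        (singularHomology.map ℤ ℤ d.jBC 2 (singularHomology.map ℤ ℤ s 2 σS)) =
        singularHomology.map ℤ ℤ (inr₁.comp (d.jBC.comp s)) 2 σS := by
      rw [singularHomology.map_comp, singularHomology.map_comp]
      rfl
    rw [hinrE, singularHomology.map_comp, ModuleCat.comp_apply, h3, hbelt]
    simp
  -- the classes `b₀ = jB_* s_* [S²]`, `bⱼ₊₁ = jA_* b'ⱼ`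
  refine ⟨Fin.cons (singularHomology.map ℤ ℤ d.jBC 2 (singularHomology.map ℤ ℤ s 2 σS))
    (fun i => singularHomology.map ℤ ℤ d.jAC 2 (inv vA (b' i))), ?_, ?_, ?_⟩
  · -- (P1): the new classes die in `E`
    refine Fin.cases ?_ (fun i => ?_)
    · rw [Fin.cons_zero]
      exact hB
    · rw [Fin.cons_succ, hA, hvA, hP1', map_zero]
  · -- (P2): classes orthogonal to all `βⱼ` come from `X`
    intro x hx
    obtain ⟨yA, zB, rfl⟩ := d.exists_eq_map_jAC_add_map_jBC x
    -- the new condition: `zB` is a multiple of the belt sphere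
    have h0 : freeKroneckerPairing ((𝕊 2) × (𝕊 2)) 2 (SphereProd.gBasis 0) (vB zB) = 0 := by
      have h := hx 0
      rw [hβ0, hΦapply, map_zero, zero_add, SphereProd.hyperbolicIsometryEquiv_single_zero, map_add,
        d.freeKroneckerPairing_map_collapseRight_map_jAC two_ne_zero,
        d.freeKroneckerPairing_map_collapseRight_map_jBC, zero_add, ← hvB_def] at h
      exact h
    have hzB' := SphereProd.eq_smul_y_one_of_freeKroneckerPairing_gBasis_zero _ h0
    have hzB : zB = freeKroneckerPairing ((𝕊 2) × (𝕊 2)) 2 (SphereProd.gBasis 1) (vB zB) •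
        singularHomology.map ℤ ℤ s 2 σS := by
      apply hvBinj
      rw [map_zsmul, hy1]
      exact hzB'
    -- the old conditions
    have hold : ∀ i, freeKroneckerPairing M' 2 (β' i) (vA yA) = 0 := fun i => by
      have hi := hx i.succ
      rw [hβs, hΦapply, map_zero, add_zero, map_add,
        d.freeKroneckerPairing_map_collapseLeft_map_jAC,
        d.freeKroneckerPairing_map_collapseLeft_map_jBC two_ne_zero, add_zero, ← hvA_def] at hi
      exact hi
    obtain ⟨w, hw⟩ := hP2' (vA yA) hold
    refine ⟨w, ?_⟩
    have hzE : singularHomology.map ℤ ℤ inrE 2 (singularHomology.map ℤ ℤ d.jBC 2 zB) = 0 := by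
      rw [hzB, map_zsmul, map_zsmul, hB, zsmul_zero]
    rw [map_add, hA, hw, hzE, add_zero, hinlE]
  · -- (P3): the classes `b_l` are dual to `ε_l β_l`
    intro γ l
    obtain ⟨⟨γ₁, γ₂⟩, rfl⟩ := Φ.surjective γ
    refine Fin.cases ?_ (fun i => ?_) l
    · rw [Fin.cons_zero, Fin.cons_zero, hβ0, hΦ, hΦapply, map_add, LinearMap.add_apply,
        d.freeKroneckerPairing_map_collapseLeft_map_jBC two_ne_zero,
        d.freeKroneckerPairing_map_collapseRight_map_jBC, zero_add, ← hvB_def, hy1]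
      obtain ⟨v, rfl⟩ := (SphereProd.hyperbolicIsometryEquiv μS').toLinearEquiv.surjective γ₂
      change freeKroneckerPairing ((𝕊 2) × (𝕊 2)) 2 (SphereProd.hyperbolicIsometryEquiv μS' v)
          (SphereProd.y (k := 2) le_rfl 1) =
        Q⟦μS'⟧ (SphereProd.gBasis 0) (SphereProd.gBasis 1) *
          (Q⟦μM'⟧ γ₁ 0 + Q⟦μS'⟧ (SphereProd.hyperbolicIsometryEquiv μS' v)
            (SphereProd.hyperbolicIsometryEquiv μS' (Pi.single 0 1)))
      rw [LinearMap.map_zero, zero_add, SphereProd.freeKroneckerPairing_hyperbolicIsometryEquiv_y_one,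
        (SphereProd.hyperbolicIsometryEquiv μS').map_app, hyperbolicForm_apply]
      simp
    · rw [Fin.cons_succ, Fin.cons_succ, hβs, hΦ, hΦapply, map_add, LinearMap.add_apply,
        d.freeKroneckerPairing_map_collapseLeft_map_jAC,
        d.freeKroneckerPairing_map_collapseRight_map_jAC two_ne_zero, add_zero, ← hvA_def, hvA,
        hP3']
      change _ = ε' i * (Q⟦μM'⟧ γ₁ (β' i) + Q⟦μS'⟧ γ₂ 0)
      rw [LinearMap.map_zero, add_zero]

end Step

/-! ### §E The form of one more stabilisation; the base case `k = 0` -/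

section Form

/-- Local notation: `Q⟦μ⟧` is the intersection form on `H²(·; ℤ)/T`. -/
local notation "Q⟦" μ "⟧" =>
  Literature.AlgebraicTopology.SingularHomology.intersectionForm two_add_two_eq_four μ

variable {X M' P : Type} [TopologicalSpace X] [TopologicalSpace M'] [TopologicalSpace P]

/-- **`Q_P ≅ Q_X ⊥ (k + 1) H` from `Q_{M'} ≅ Q_X ⊥ k H`, `Q_P ≅ Q_{M'} ⊥ Q_S` and `Q_S ≅ H`**
(Kirby 1989, Ch. II §1: the form of a connected sum is the orthogonal sum, `S² × S²` has form `H`),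
for the splitting `Θ (a, c) = Φ (Θ' (a, tail c), Θ_S (c 0))`. [cite: Kirby1989, Ch. II §1] -/
theorem step_form {k : ℕ} (μX' : HomologicalOrientation ℤ X 4) (μM' : HomologicalOrientation ℤ M' 4)
    (μS' : HomologicalOrientation ℤ ((𝕊 2) × (𝕊 2)) 4) (μP : HomologicalOrientation ℤ P 4)
    (Θ' : (↥(freeCohomology ℤ X 2) × (Fin k → Fin 2 → ℤ)) ≃+ ↥(freeCohomology ℤ M' 2))
    (ΘS : hyperbolicForm.IsometryEquiv (Q⟦μS'⟧))
    (Φ : (↥(freeCohomology ℤ M' 2) × ↥(freeCohomology ℤ ((𝕊 2) × (𝕊 2)) 2)) ≃+ ↥(freeCohomology ℤ P 2))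
    (hΦ : ∀ x y, Q⟦μP⟧ (Φ x) (Φ y) = Q⟦μM'⟧ x.1 y.1 + Q⟦μS'⟧ x.2 y.2)
    (hP4' : ∀ x y, Q⟦μM'⟧ (Θ' x) (Θ' y) = Q⟦μX'⟧ x.1 y.1 + ∑ j, hyperbolicForm (x.2 j) (y.2 j))
    (Θ : (↥(freeCohomology ℤ X 2) × (Fin (k + 1) → Fin 2 → ℤ)) ≃+ ↥(freeCohomology ℤ P 2))
    (hΘ : ∀ a c, Θ (a, c) = Φ (Θ' (a, Fin.tail c), ΘS.toLinearEquiv.toAddEquiv (c 0))) (x y) :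
    Q⟦μP⟧ (Θ x) (Θ y) = Q⟦μX'⟧ x.1 y.1 + ∑ j, hyperbolicForm (x.2 j) (y.2 j) := by
  obtain ⟨a, c⟩ := x
  obtain ⟨a', c'⟩ := y
  rw [hΘ, hΘ, hΦ]
  change Q⟦μM'⟧ (Θ' (a, Fin.tail c)) (Θ' (a', Fin.tail c')) + Q⟦μS'⟧ (ΘS (c 0)) (ΘS (c' 0)) = _
  rw [hP4', ΘS.map_app, Fin.sum_univ_succ]
  simp only [Fin.tail]
  ring

variable [T2Space X] [SecondCountableTopology X] [ChartedSpace (𝔼 4) X] [CompactSpace X]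
  [IsManifold (𝓡 4) ∞ X] [SimplyConnectedSpace X] [T2Space P] [ChartedSpace (𝔼 4) P]
  [IsManifold (𝓡 4) ∞ P]

/-- **Up to reversing an orientation, a homeomorphism of closed connected manifolds has degree
`1`** (`[M]_{-μ} = -[M]_μ`; Hatcher 2002, §2.2 and Thm. 3.26). [cite: HatcherAT2002, §3.3 Thm. 3.26 and p. 236] -/
theorem exists_hasDegree_one_of_homeomorph {Y Z : Type} [TopologicalSpace Y] [T2Space Y]
    [CompactSpace Y] [ChartedSpace (𝔼 4) Y] [ConnectedSpace Y] [TopologicalSpace Z] [T2Space Z]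
    [CompactSpace Z] [ChartedSpace (𝔼 4) Z] [ConnectedSpace Z]
    (μ : HomologicalOrientation ℤ Y 4) (ν : HomologicalOrientation ℤ Z 4) (e : Y ≃ₜ Z) :
    ∃ ν' : HomologicalOrientation ℤ Z 4, (ν' = ν ∨ ν' = -ν) ∧ HasDegree μ ν' (e : C(Y, Z)) 1 := by
  rcases hasDegree_one_or_neg_one_of_homotopyEquiv μ ν e.toHomotopyEquiv with h | h
  · exact ⟨ν, Or.inl rfl, h⟩
  · refine ⟨-ν, Or.inr rfl, ?_⟩
    rw [HasDegree, HomologicalOrientation.fundamentalClass_neg_holds ℤ Z 4 ν, one_zsmul]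
    rw [HasDegree, neg_one_zsmul] at h
    exact h

/-- **The base of the induction (`k = 0`): a diffeomorphism `φ : X ≅ P`** gives the cylinder
`X × [0, 1]` re-ended by `φ` as a cobordism `E : X ~ P`, simply connected with `H₂(P) → H₂(E)`
onto (indeed `inr_* x ∈ im inl_*` for all `x`), and `φ⁻¹* : H²(X)/T ≅ H²(P)/T` is an isometry
`Q⟦±μ_X⟧ ≅ Q⟦μ_P⟧` (degree `±1`). [cite: Kirby1989, Ch. X, proof of Thm. 1, p. 55] [cite: MilnorHusemoller1973, §V.1] -/
theorem base_data (φ : X ≃ₘ⟮𝓡 4, 𝓡 4⟯ P) (μX : HomologicalOrientation ℤ X 4)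
    (μP : HomologicalOrientation ℤ P 4) :
    ∃ (E : Cobordism 4 X P) (Θ₀ : ↥(freeCohomology ℤ X 2) ≃+ ↥(freeCohomology ℤ P 2))
      (μX' : HomologicalOrientation ℤ X 4),
      SimplyConnectedSpace E.W ∧
      Epi (singularHomology.map ℤ ℤ (⟨E.inr, E.continuous_inr⟩ : C(P, E.W)) 2) ∧
      (μX' = μX ∨ μX' = -μX) ∧
      (∀ x : singularHomology ℤ ℤ P 2, ∃ w : singularHomology ℤ ℤ X 2,
        singularHomology.map ℤ ℤ (⟨E.inr, E.continuous_inr⟩ : C(P, E.W)) 2 x =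
          singularHomology.map ℤ ℤ (⟨E.inl, E.continuous_inl⟩ : C(X, E.W)) 2 w) ∧
      (∀ x y, Q⟦μP⟧ (Θ₀ x) (Θ₀ y) = Q⟦μX'⟧ x y) := by
  haveI : CompactSpace P := φ.toHomeomorph.compactSpace
  haveI : ConnectedSpace X := inferInstance
  haveI : SimplyConnectedSpace P := φ.toHomeomorph.symm.toHomotopyEquiv.simplyConnectedSpace
  -- the cylinder, re-ended by `φ`
  let C : Cobordism 4 X X := cylinderCobordism 4 X
  let E : Cobordism 4 X P := C.compDiffeomorphRight φ.symm
  -- the ends of the cylinder are homology isomorphisms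
  haveI h0 : IsIso (singularHomology.map ℤ ℤ (⟨C.inl, C.continuous_inl⟩ : C(X, C.W)) 2) :=
    (singularHomology.isoOfHomotopyEquiv ℤ ℤ
      (Cylinder.sliceHomotopyEquiv (M := X) 0 ⟨le_rfl, zero_le_one⟩) 2).isIso_hom
  haveI h1 : IsIso (singularHomology.map ℤ ℤ (⟨C.inr, C.continuous_inr⟩ : C(X, C.W)) 2) :=
    (singularHomology.isoOfHomotopyEquiv ℤ ℤ
      (Cylinder.sliceHomotopyEquiv (M := X) 1 ⟨zero_le_one, le_rfl⟩) 2).isIso_hom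
  haveI hφ : IsIso (singularHomology.map ℤ ℤ (φ.symm.toHomeomorph : C(P, X)) 2) :=
    (singularHomology.mapIso ℤ ℤ φ.symm.toHomeomorph 2).isIso_hom
  -- the orientation making `φ⁻¹` of degree one
  obtain ⟨μX', hμX', hdeg⟩ := exists_hasDegree_one_of_homeomorph μP μX φ.symm.toHomeomorph
  refine ⟨E, (freeCohomology.mapEquiv (R := ℤ) φ.symm.toHomeomorph 2).toAddEquiv, μX', ?_, ?_,
    hμX', fun x => ?_, fun x y => ?_⟩
  · -- the cylinder is simply connected
    show SimplyConnectedSpace ↥(Cylinder.carrier X)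
    exact (Cylinder.sliceHomotopyEquiv (M := X) 0 ⟨le_rfl, zero_le_one⟩).symm.simplyConnectedSpace
  · change Epi (singularHomology.map ℤ ℤ
      ((⟨C.inr, C.continuous_inr⟩ : C(X, C.W)).comp (φ.symm.toHomeomorph : C(P, X))) 2)
    rw [singularHomology.map_comp]
    infer_instance
  · obtain ⟨w, hw⟩ := ((ConcreteCategory.isIso_iff_bijective
      (singularHomology.map ℤ ℤ (⟨C.inl, C.continuous_inl⟩ : C(X, C.W)) 2)).1 h0).2
      (singularHomology.map ℤ ℤ (⟨E.inr, E.continuous_inr⟩ : C(P, E.W)) 2 x)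
    exact ⟨w, hw.symm⟩
  · change Q⟦μP⟧ (freeCohomology.map (R := ℤ) (φ.symm.toHomeomorph : C(P, X)) 2 x)
        (freeCohomology.map (R := ℤ) (φ.symm.toHomeomorph : C(P, X)) 2 y) = _
    rw [intersectionForm_map_map two_add_two_eq_four μP μX' hdeg, one_mul]

end Form

/-! ### §F The half bordism `X ~ X # k(S² × S²)` with its lattice data -/

section Assembly

/-- Local notation: `Q⟦μ⟧` is the intersection form on `H²(·; ℤ)/T`. -/
local notation "Q⟦" μ "⟧" =>
  Literature.AlgebraicTopology.SingularHomology.intersectionForm two_add_two_eq_four μ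

set_option maxHeartbeats 800000 in
/-- **The cobordism of `k` trivially attached 2-handles, with its lattice data** (Kirby 1989,
Ch. X, proof of Thm. 1, pp. 55–56; module docstring).  For a closed simply connected smooth
4-manifold `X` and a `k`-fold stabilisation `P` of `X` (`IsStabilization k X P`): `P` is simply
connected, compact and second countable, and for all `ℤ`-orientations `μ_X`, `μ_P` there are a
cobordism `E : X ~ P` with `E.W` simply connected and `H₂(P) → H₂(E)` onto, classes
`bⱼ ∈ H₂(P; ℤ)` (`j < k`), an additive identification `Θ : H²(X)/T ⊕ (ℤ²)ᵏ ≅ H²(P)/T`, signs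
`εⱼ = ±1` and `μ_X' = ±μ_X` such that, with `βⱼ = Θ (0, eⱼ ⊗ (1, 0))`: `inr_* bⱼ = 0`;
`⟨βⱼ, x⟩ = 0 ∀ j ⇒ inr_* x ∈ im inl_*`; `⟨γ, b_l⟩ = ε_l Q_P (γ, β_l)`; and
`Q_P (Θ x, Θ y) = Q⟦μ_X'⟧ (x₁, y₁) + Σⱼ H (x₂ⱼ, y₂ⱼ)`.
[cite: Kirby1989, Ch. X, proof of Thm. 1, pp. 55–56] [cite: WallJLMS1964, §2 pp. 145–146] -/
theorem exists_stabilisationCobordism (k : ℕ) :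
    ∀ (X : Type) [TopologicalSpace X] [T2Space X] [SecondCountableTopology X]
      [ChartedSpace (𝔼 4) X] [CompactSpace X] [IsManifold (𝓡 4) ∞ X] [SimplyConnectedSpace X]
      (P : Type) [TopologicalSpace P] [T2Space P] [ChartedSpace (𝔼 4) P] [IsManifold (𝓡 4) ∞ P],
      IsStabilization k X P →
      SimplyConnectedSpace P ∧ CompactSpace P ∧ SecondCountableTopology P ∧
      ∀ (μX : HomologicalOrientation ℤ X 4) (μP : HomologicalOrientation ℤ P 4),
        ∃ (E : Cobordism 4 X P) (b : Fin k → singularHomology ℤ ℤ P 2)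
          (Θ : (↥(freeCohomology ℤ X 2) × (Fin k → Fin 2 → ℤ)) ≃+ ↥(freeCohomology ℤ P 2))
          (ε : Fin k → ℤ) (μX' : HomologicalOrientation ℤ X 4),
          SimplyConnectedSpace E.W ∧
          Epi (singularHomology.map ℤ ℤ (⟨E.inr, E.continuous_inr⟩ : C(P, E.W)) 2) ∧
          (μX' = μX ∨ μX' = -μX) ∧
          (∀ j, ε j * ε j = 1) ∧
          (∀ j, singularHomology.map ℤ ℤ (⟨E.inr, E.continuous_inr⟩ : C(P, E.W)) 2 (b j) = 0) ∧
          (∀ x : singularHomology ℤ ℤ P 2,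
            (∀ j, freeKroneckerPairing P 2 (Θ (0, Pi.single j (Pi.single 0 1))) x = 0) →
            ∃ w : singularHomology ℤ ℤ X 2,
              singularHomology.map ℤ ℤ (⟨E.inr, E.continuous_inr⟩ : C(P, E.W)) 2 x =
                singularHomology.map ℤ ℤ (⟨E.inl, E.continuous_inl⟩ : C(X, E.W)) 2 w) ∧
          (∀ (γ : freeCohomology ℤ P 2) (l : Fin k),
            freeKroneckerPairing P 2 γ (b l) =
              ε l * Q⟦μP⟧ γ (Θ (0, Pi.single l (Pi.single 0 1)))) ∧
          (∀ x y, Q⟦μP⟧ (Θ x) (Θ y) = Q⟦μX'⟧ x.1 y.1 + ∑ j, hyperbolicForm (x.2 j) (y.2 j)) := by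
  induction k with
  | zero =>
    intro X _ _ _ _ _ _ _ P _ _ _ _ hst
    obtain ⟨φ⟩ := (isStabilization_zero_iff X P).1 hst
    haveI : CompactSpace P := φ.toHomeomorph.compactSpace
    haveI : SecondCountableTopology P := φ.symm.toHomeomorph.secondCountableTopology
    haveI : SimplyConnectedSpace P := φ.toHomeomorph.symm.toHomotopyEquiv.simplyConnectedSpace
    refine ⟨‹_›, ‹_›, ‹_›, fun μX μP => ?_⟩
    obtain ⟨E, Θ₀, μX', hsc, hepi, hμ, hall, hform⟩ := base_data φ μX μP
    refine ⟨E, Fin.elim0, (AddEquiv.prodUnique).trans Θ₀, Fin.elim0, μX', hsc, hepi, hμ,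
      fun j => j.elim0, fun j => j.elim0, fun x _ => hall x, fun γ l => l.elim0, fun x y => ?_⟩
    rw [AddEquiv.trans_apply, AddEquiv.trans_apply, hform, Finset.univ_eq_empty,
      Finset.sum_empty, add_zero]
    rfl
  | succ k ih =>
    intro X _ _ _ _ _ _ _ P _ _ _ _ hst
    obtain ⟨M', _, _, _, _, hst', hcs⟩ := (isStabilization_succ_iff k X P).1 hst
    obtain ⟨hsc', hcpt', hsnd', hdata'⟩ := ih X M' hst'
    haveI := hsc'
    haveI := hcpt'
    haveI := hsnd'
    obtain ⟨E₁, hE₁sc, d, s, hepi₁, hcyl, hs, hbelt, hPsc, hPc, hP2nd⟩ :=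
      exists_stabilisationStep M' P hcs
    refine ⟨hPsc, hPc, hP2nd, fun μX μP => ?_⟩
    haveI := hPsc
    haveI := hPc
    haveI := hP2nd
    letI : ChartedSpace (𝔼 4) ((𝕊 2) × (𝕊 2)) := SphereProd.chartedSpace 2
    haveI : SimplyConnectedSpace ((𝕊 2) × (𝕊 2)) := SphereProd.simplyConnectedSpace le_rfl
    -- orientations, and the form of `P = M' # S² × S²`
    obtain ⟨μM'₀⟩ := isOrientableOver_of_simplyConnectedSpace ℤ M' (n := 4)
    obtain ⟨μS⟩ : IsOrientableOver ℤ ((𝕊 2) × (𝕊 2)) 4 := SphereProd.isOrientableOver le_rfl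
    obtain ⟨μM', μS', -, -, hΦ⟩ := d.exists_addEquiv_intersectionForm_eq (m := 3) (by norm_num)
      le_rfl two_add_two_eq_four μM'₀ μS μP
    have hΦapply : ∀ ac, d.collapseSumAddEquiv (m := 3) (k := 2) (by norm_num) le_rfl
        (by norm_num) (by norm_num) ac =
        freeCohomology.map d.collapseLeft 2 ac.1 + freeCohomology.map d.collapseRight 2 ac.2 :=
      fun ac => rfl
    -- the induction hypothesis for `M'`, oriented by `μM'`
    obtain ⟨E', b', Θ', ε', μX', hE'sc, hepi', hμX', hε', hP1', hP2', hP3', hP4'⟩ := hdata' μX μM'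
    -- the composite `E = E' ∪ E₁`
    obtain ⟨E, e₁, e₂, -, -, hseam, hinr, hinl, hscE, hMV⟩ := Cobordism.exists_composite E' E₁
    haveI : Epi (biprod.desc (singularHomology.map ℤ ℤ e₁ 2) (singularHomology.map ℤ ℤ e₂ 2)) :=
      hMV inferInstance 1 (isZero_singularHomology_one_of_simplyConnectedSpace ℤ ℤ (X := M'))
    -- the identification `Θ` with one more hyperbolic summand, and the classes `βⱼ`
    obtain ⟨Θ, hΘ⟩ := exists_addEquiv_cons Θ'
      (SphereProd.hyperbolicIsometryEquiv μS').toLinearEquiv.toAddEquiv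
      (d.collapseSumAddEquiv (m := 3) (k := 2) (by norm_num) le_rfl (by norm_num) (by norm_num))
    have hβ0 : Θ (0, Pi.single 0 (Pi.single 0 1)) =
        d.collapseSumAddEquiv (m := 3) (k := 2) (by norm_num) le_rfl (by norm_num) (by norm_num)
          (0, SphereProd.hyperbolicIsometryEquiv μS' (Pi.single 0 1)) := by
      rw [hΘ, tail_single_zero, Pi.single_eq_same, Prod.mk_zero_zero, map_zero]
      rfl
    have hβs : ∀ i : Fin k, Θ (0, Pi.single i.succ (Pi.single 0 1)) =
        d.collapseSumAddEquiv (m := 3) (k := 2) (by norm_num) le_rfl (by norm_num) (by norm_num)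
          (Θ' (0, Pi.single i (Pi.single 0 1)), 0) := by
      intro i
      rw [hΘ, tail_single_succ, single_succ_apply_zero, map_zero]
    -- the homological data
    obtain ⟨b, hP1, hP2, hP3⟩ := step_homology d E' E₁ E e₁ e₂ hseam hinr hinl s _ hs hcyl hbelt
      b' (fun j => Θ' (0, Pi.single j (Pi.single 0 1))) ε' μM' μS' μP hP1' hP2' hP3' _ hΦapply hΦ
      (fun j => Θ (0, Pi.single j (Pi.single 0 1))) hβ0 hβs
    refine ⟨E, b, Θ, Fin.cons (Q⟦μS'⟧ (SphereProd.gBasis 0) (SphereProd.gBasis 1)) ε', μX',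
      hscE hE'sc hE₁sc inferInstance,
      epi_map_inr_of_pieces E' E₁ E e₁ e₂ hseam hinr hepi' hepi₁, hμX', ?_, hP1, hP2, hP3,
      step_form μX' μM' μS' μP Θ' (SphereProd.hyperbolicIsometryEquiv μS') _ hΦ hP4' Θ hΘ⟩
    refine Fin.cases ?_ (fun i => ?_)
    · rw [Fin.cons_zero]
      exact SphereProd.intersectionForm_gBasis_mul_self μS'
    · rw [Fin.cons_succ]
      exact hε' i

end Assembly

end Literature.Topology.FourManifolds

end
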